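import Literature.AlgebraicGeometry.HodgeTheory.BettiKunnethPieceHodgeClassesHomEquiv
import Literature.AlgebraicGeometry.HodgeTheory.BettiHodgeConjectureProductOfSurfacesCorrespondenceCriterion
import HarnessLib

/-!
# `HC(Y × Z)` makes every morphism of Hodge structures `Hᵃ(Z) → Hⁱ(Y)(r)` (`r ≥ 0`) the action of an algebraic correspondence; **`HC(S × S')` for two smooth projective surfaces IFF every morphism of
# `ℚ`-Hodge structures `H²(S') → H²(S)` is induced by a rational algebraic class of `H⁴(S × S')`** — with genuine `HodgeStructure.Hom` terms
# (Voisin I §7.3.1 Def. 7.22, §11.3.3 Thm. 11.38–11.40, Lemma 11.41, pp. 285–287; Voisin 2025 §3.2.1; Deligne 2000 §1)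

Family `hodge`, lane `lit-hodgefound` (Track 2 foundations library; Layers A1/A4), layer `Literature/AlgebraicGeometry/HodgeTheory`.  THEOREMS ONLY (no definition, no named fact, no instance;
D-0026 net debt `0`).  The seat's g30-#17 packaged Lemma 11.41 into morphisms of Hodge structures for non-negative bidegree: the Hodge classes `t` of the Künneth summand `Hⁱ(Y;ℚ) ⊗ Hʲ(Z;ℚ)`
(`i + j = 2c`, `a + j = 2n`, `c = n + r`) correspond to the `φ ∈ Hom_HS(Hᵃ(Z), Hⁱ(Y)(r))` with `φ(v) ⊗ 1 = (crossMap t ⊗ 1)_*(v ⊗ 1)`.  §1: under `HC(Y × Z)` every such `φ` is therefore the action of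
an ALGEBRAIC class.  §2: for two surfaces (`a = i = j = 2`, `r = 0`; the twist by `0` is removed by §0's two conversions) the seat's g30-#5 criterion becomes the classical statement with honest
`HodgeStructure.Hom (BettiUniverse.hodge hHD hS' 2) (BettiUniverse.hodge hHD hS 2)`: **`HC(S × S')` iff for every morphism of Hodge structures `φ : H²(S') → H²(S)` there is a rational algebraic class
`γ ∈ H⁴(S × S';ℚ)` with `(γ ⊗ 1)_*(v ⊗ 1) = φ(v) ⊗ 1` for all `v ∈ H²(S';ℚ)`** (complex orientations) — for K3 surfaces: iff every Hodge morphism between the second cohomologies (equivalently between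
the transcendental lattices, the algebraic part being accounted for by products of divisors) is algebraic.

WHAT IS PROVED.
* §0 `exists_hom_tateTwist_zero_cast_of_hom`, `exists_hom_of_hom_tateTwist_zero_cast` (a morphism into `H` is a morphism into `(H(0)).cast _` and conversely, same `ℚ`-linear map).
* §1 **`BettiUniverse.exists_algebraic_corrAction_eq_ofRatClass_hom_of_hodgeConjectureFor`** (`HC(Y × Z)`, `c = n + r` ⇒ every `φ ∈ Hom_HS(HᵃZ, HⁱY(r))` is the action of the algebraic Hodge class `crossMap t`).
* §2 **`BettiUniverse.hodgeConjectureFor_tensor_surfaces_iff_forall_hom_exists_algebraic`** (the title statement).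

THE PRINTS.  C. Voisin (2002) [VoisinHodgeI2002] §7.3.1 Def. 7.22; §11.3.3 Thm. 11.38–11.40, Lemma 11.41 and pp. 285–287.  C. Voisin (2025) [Voisin2025] §3.2.1 (12)–(14), Prop. 3.8, Cor. 3.9.  P. Deligne (2000/2006) [Deligne2000] §1.
P. Deligne (1971) [DeligneHodgeII1971] 2.1.13–2.1.14.

THE OBJECTS (all the tree's).  `HodgeStructure.Hom`, `tateTwist`, `cast`, `BettiUniverse.hodge`, `corrAction complexOrientationFamily`, `BettiUniverse.crossMap`, `BettiUniverse.kunnethSummand`, `hodgeClasses`, `ofRatClass`, `algebraicClasses`,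
`HodgeConjectureFor`; the seat's g30-#17 `…exists_mem_hodgeClasses_corrAction_crossMap_eq_ofRatClass_hom`, `…exists_hom_tateTwist_of_mem_hodgeClasses_kunnethSummand`, g30-#14 `…mem_hodgeClasses_kunnethSummand_iff_isOfHodgeType`,
g30-#13 `BettiUniverse.span_range_ofRatClass_eq_top`, g30-#5 `…hodgeConjectureFor_tensor_surfaces_iff_forall_exists_corrAction_eq`.

DEVIATIONS / SCOPE.  Complex orientations; non-negative bidegree in §1.  No definitions.

## References
* [VoisinHodgeI2002] C. Voisin, *Hodge Theory and Complex Algebraic Geometry I* (2002) — §7.3.1 Def. 7.22; §11.3.3 Thm. 11.38–11.40, Lemma 11.41, pp. 285–287.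
* [Voisin2025] C. Voisin, *Cycle classes on algebraic varieties* (2025) — §3.2.1 (12)–(14), Prop. 3.8, Cor. 3.9.
* [Deligne2000] P. Deligne, *The Hodge conjecture* (Clay problem description) — §1.
* [DeligneHodgeII1971] P. Deligne, *Théorie de Hodge II* (1971) — 2.1.13–2.1.14.

## Provenance
Lane `lit-hodgefound` (Hodge path, Track 2), prover seat `lit-hodgefound-p29` (generation 30), self-proposed row g30-#18 (g30-#17 + g30-#5: the classical `Hom_HS` formulation of `HC(S × S')`).
-/

noncomputable section

open scoped TensorProduct
open CategoryTheory MonoidalCategory CartesianMonoidalCategory Module Finset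
open Literature.AlgebraicTopology.SingularHomology
open Literature.Geometry.Kaehler

namespace Literature.AlgebraicGeometry.HodgeTheory

open Literature.AlgebraicGeometry.Motives
open Literature.AlgebraicGeometry.Motives.HodgeStructure

variable {m n : ℕ} {Y Z S S' : SchemeOver ℂ}

/-! ### §0 Morphisms into `H` versus morphisms into `(H(0)).cast _` -/

/-- A morphism of Hodge structures `H₁ → H₂` is a morphism `H₁ → (H₂(0)).cast _` with the same `ℚ`-linear map (`F^p H₂(0) = F^{p+0} H₂`). [cite: DeligneHodgeII1971, 2.1.13–2.1.14] -/
theorem exists_hom_tateTwist_zero_cast_of_hom {V W : Type} [AddCommGroup V] [Module ℚ V] [AddCommGroup W] [Module ℚ W] {k : ℤ} (H₁ : HodgeStructure V k) (H₂ : HodgeStructure W k)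
    (hw : k - 2 * ((0 : ℕ) : ℤ) = k) (φ : HodgeStructure.Hom H₁ H₂) :
    ∃ ψ : HodgeStructure.Hom H₁ ((H₂.tateTwist ((0 : ℕ) : ℤ)).cast hw), ψ.toLinearMap = φ.toLinearMap :=
  ⟨⟨φ.toLinearMap, fun p ↦ by
    rw [HodgeStructure.cast_F, HodgeStructure.tateTwist_F]
    exact (φ.map_F_le p).trans_eq (by rw [Nat.cast_zero, add_zero])⟩, rfl⟩

/-- Conversely, a morphism `H₁ → (H₂(0)).cast _` is a morphism `H₁ → H₂` with the same `ℚ`-linear map. [cite: DeligneHodgeII1971, 2.1.13–2.1.14] -/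
theorem exists_hom_of_hom_tateTwist_zero_cast {V W : Type} [AddCommGroup V] [Module ℚ V] [AddCommGroup W] [Module ℚ W] {k : ℤ} (H₁ : HodgeStructure V k) (H₂ : HodgeStructure W k)
    (hw : k - 2 * ((0 : ℕ) : ℤ) = k) (ψ : HodgeStructure.Hom H₁ ((H₂.tateTwist ((0 : ℕ) : ℤ)).cast hw)) :
    ∃ φ : HodgeStructure.Hom H₁ H₂, φ.toLinearMap = ψ.toLinearMap :=
  ⟨⟨ψ.toLinearMap, fun p ↦ by
    have h := ψ.map_F_le p
    rw [HodgeStructure.cast_F, HodgeStructure.tateTwist_F] at h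
    exact h.trans_eq (by rw [Nat.cast_zero, add_zero])⟩, rfl⟩

section Betti

variable [HodgeTensorFacts.{0, 0}]

/-! ### §1 `HC(Y × Z)` ⇒ morphisms `Hᵃ(Z) → Hⁱ(Y)(r)` are actions of algebraic classes -/

/-- **`HC(Y × Z)` ⇒ every morphism of Hodge structures `φ : Hᵃ(Z) → Hⁱ(Y)(r)` (`i + j = 2c`, `a + j = 2n`, `c = n + r`) is the action of a rational ALGEBRAIC class of `H^{2c}(Y × Z)`: `(γ ⊗ 1)_*(v ⊗ 1) = φ(v) ⊗ 1`**
(`γ = crossMap t`, `t` the Hodge class of the summand with `φ = φ_t`, algebraic by `HC`; complex orientations). [cite: VoisinHodgeI2002, §7.3.1 Def. 7.22, §11.3.3 Lemma 11.41 and pp. 285–287]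
[cite: Voisin2025, §3.2.1 (12)–(14), Prop. 3.8 and Cor. 3.9] [cite: Deligne2000, §1] -/
theorem BettiUniverse.exists_algebraic_corrAction_eq_ofRatClass_hom_of_hodgeConjectureFor (hHD : exists_isReal_hodgeModel) (hY : IsSmoothProjective m Y) (hZ : IsSmoothProjective n Z)
    (hHC : HodgeConjectureFor (m + n) (Y ⊗ Z)) {c i j a r : ℕ} (hij : i + j = 2 * c) (haj : a + j = 2 * n) (hab : a + 2 * c = i + 2 * n) (hr : n + r = c) (hw : ((i : ℕ) : ℤ) - 2 * (r : ℤ) = ((a : ℕ) : ℤ))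
    (φ : HodgeStructure.Hom (BettiUniverse.hodge hHD hZ a) (((BettiUniverse.hodge hHD hY i).tateTwist (r : ℤ)).cast hw)) :
    ∃ γ : bettiCohomology (Y ⊗ Z) (2 * c), ofRatClass (ComplexPoints (Y ⊗ Z)) (2 * c) γ ∈ algebraicClasses (Y ⊗ Z) c ∧
      ∀ v, corrAction complexOrientationFamily hY hZ hab (ofRatClass (ComplexPoints (Y ⊗ Z)) (2 * c) γ) (ofRatClass (ComplexPoints Z) a v) = ofRatClass (ComplexPoints Y) i (φ.toLinearMap v) := by
  obtain ⟨t, ht, htφ⟩ := BettiUniverse.exists_mem_hodgeClasses_corrAction_crossMap_eq_ofRatClass_hom hHD hY hZ hij haj hab hr hw φ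
  exact ⟨_, hHC.2 c _ (isRationalClass_ofRatClass _) ((BettiUniverse.mem_hodgeClasses_kunnethSummand_iff_isOfHodgeType hHD hY hZ hij t).1 ht), htφ⟩

/-! ### §2 Two surfaces -/

/-- **`HC(S × S')` IFF every morphism of `ℚ`-Hodge structures `φ : H²(S') → H²(S)` is induced by a rational algebraic class `γ` of `H⁴(S × S')`: `(γ ⊗ 1)_*(v ⊗ 1) = φ(v) ⊗ 1` for all `v ∈ H²(S';ℚ)`**
(`S`, `S'` arbitrary smooth projective surfaces; complex orientations).  «⇒»: §1 with `r = 0`.  «⇐»: by the seat's g30-#5 it suffices that every Hodge class `t` of `H²(S) ⊗ H²(S')` act as an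
algebraic class does; its `φ_t ∈ Hom_HS(H²S', H²S)` (g30-#17) is induced by an algebraic `γ`, and two ℂ-linear maps agreeing on the rational classes agree.
[cite: VoisinHodgeI2002, §7.3.1 Def. 7.22, §11.3.3 Thm. 11.38–11.40, Lemma 11.41 and pp. 285–287] [cite: Voisin2025, §3.2.1 (12)–(14), Prop. 3.8 and Cor. 3.9] [cite: Deligne2000, §1] -/
theorem BettiUniverse.hodgeConjectureFor_tensor_surfaces_iff_forall_hom_exists_algebraic (hHD : exists_isReal_hodgeModel) (hS : IsSmoothProjective 2 S) (hS' : IsSmoothProjective 2 S')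
    (hSS' : IsSmoothProjective 4 (S ⊗ S')) :
    HodgeConjectureFor 4 (S ⊗ S') ↔
      ∀ φ : HodgeStructure.Hom (BettiUniverse.hodge hHD hS' 2) (BettiUniverse.hodge hHD hS 2),
        ∃ γ : bettiCohomology (S ⊗ S') (2 * 2), ofRatClass (ComplexPoints (S ⊗ S')) (2 * 2) γ ∈ algebraicClasses (S ⊗ S') 2 ∧
          ∀ v, corrAction complexOrientationFamily hS hS' (rfl : 2 + 2 * 2 = 2 + 2 * 2) (ofRatClass (ComplexPoints (S ⊗ S')) (2 * 2) γ) (ofRatClass (ComplexPoints S') 2 v) =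
            ofRatClass (ComplexPoints S) 2 (φ.toLinearMap v) := by
  have hw : (((2 : ℕ) : ℕ) : ℤ) - 2 * (((0 : ℕ) : ℕ) : ℤ) = (((2 : ℕ) : ℕ) : ℤ) := by norm_num
  constructor
  · intro hHC φ
    obtain ⟨ψ, hψ⟩ := exists_hom_tateTwist_zero_cast_of_hom _ _ hw φ
    obtain ⟨γ, hγ, hact⟩ := BettiUniverse.exists_algebraic_corrAction_eq_ofRatClass_hom_of_hodgeConjectureFor hHD hS hS' hHC (show 2 + 2 = 2 * 2 by norm_num) (show 2 + 2 = 2 * 2 by norm_num)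
      (rfl : 2 + 2 * 2 = 2 + 2 * 2) (show 2 + 0 = 2 by norm_num) hw ψ
    exact ⟨γ, hγ, fun v ↦ by rw [hact v, hψ]⟩
  · intro h
    rw [BettiUniverse.hodgeConjectureFor_tensor_surfaces_iff_forall_exists_corrAction_eq complexOrientationFamily hHD hS hS' hSS']
    intro t ht
    obtain ⟨ψ, hψ⟩ := BettiUniverse.exists_hom_tateTwist_of_mem_hodgeClasses_kunnethSummand hHD hS hS' (show 2 + 2 = 2 * 2 by norm_num) (rfl : 2 + 2 * 2 = 2 + 2 * 2) (show 2 + 0 = 2 by norm_num) hw ht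
    obtain ⟨φ, hφ⟩ := exists_hom_of_hom_tateTwist_zero_cast _ _ hw ψ
    obtain ⟨γ, hγ, hact⟩ := h φ
    refine ⟨γ, hγ, LinearMap.ext_on_range (BettiUniverse.span_range_ofRatClass_eq_top hS' 2) fun v ↦ ?_⟩
    rw [hact v, hφ, hψ v]

end Betti

end Literature.AlgebraicGeometry.HodgeTheory

end
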